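import Mathlib.RingTheory.Kaehler.Basic
import Mathlib.LinearAlgebra.ExteriorPower.Basic
import Mathlib.Algebra.MvPolynomial.PDeriv
import Mathlib.LinearAlgebra.Matrix.Determinant.Basic
import Mathlib.Analysis.Calculus.FDeriv.Basic
import Mathlib.Analysis.Complex.Basic
import Mathlib.MeasureTheory.Integral.Bochner.Basic
import Mathlib.MeasureTheory.Constructions.Pi
import Mathlib.MeasureTheory.Measure.Lebesgue.Basic
import Mathlib.Topology.KrullDimension
import Mathlib.AlgebraicGeometry.Morphisms.Smooth
import Literature.NumberTheory.Transcendental.Sweep1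
import Literature.NumberTheory.Transcendental.SemialgebraicMaps
import Literature.AlgebraicTopology.SingularHomology.RelativeCapProduct
import HarnessLib

/-!
# The classical period datum: an interface with the Kähler/integration normalisations

Definition request `defn-ClassicalPeriodDatum` (route `KontsevichZagierPeriods/VeryGoodTransfer`,
crux `CellwiseVGoodTransfer`, target `KZTransferPackage`; earlier route `NoriTransfer`).

## What was asked, and what can be delivered

The request is for *the classical instance* `(P, R, B)` of the three hypothesis structures
`Literature.AlgebraicGeometry.Motives.PeriodRealization k` (prelude C9: algebraic de Rham
cohomology, Betti cohomology with its Hodge structures, Grothendieck's comparison),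
`Literature.AlgebraicGeometry.Motives.RelativePeriodData P` (prelude C10: relative algebraic de
Rham cohomology of pairs and the period pairing) and `RelativePeriodData.BoundaryData R`
(`Sweep1`: the connecting morphisms of triples), over `k = ℚ̄`: relative algebraic de Rham
cohomology of pairs via the `h`-topology (Huber–Müller-Stach 2017, Ch. 3), singular homology of
the complex points, the comparison pairing and the connecting morphisms.

An honest *term* of these structures cannot be written today, and the tree says so itself: their
proof fields are Grothendieck's comparison theorem, Poincaré duality, the Hodge decomposition,
finiteness and perfectness of the relative comparison, and Mathlib has no algebraic de Rham
cohomology (no hypercohomology of `Ω•_{X/k}`) — see the docstrings of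
`Literature.AlgebraicGeometry.Motives.DeRhamRealization` ("the classical realization is a value of
this structure; that fact is not expressible in Mathlib") and of
`Literature.NumberTheory.Transcendental.ExistsCohomologicalPeriodsEqPeriods` ("the tree has no
construction of algebraic de Rham cohomology, so the classical data cannot be named"). Following
the two-speed convention of the trunk (interfaces posited, printed theorems recorded as fields,
nothing smuggled), this file therefore records the classical datum as a **hypothesis structure**
`Literature.AlgebraicGeometry.Motives.ClassicalPeriodDatum k`: a period datum `(P, R, B)` over a
field `k` of characteristic zero *together with* the printed normalisations that single out the
classical datum for the purpose of computing periods, each typed with honest objects of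
Mathlib / the tree:

* **de Rham classes of top-degree Kähler forms** (`formClass`). For a pair `Y = (X, D)` with `X`
  smooth affine of relative dimension `d` over `k` and `dim D < d` (`SchemePair.IsSmoothAffinePair`),
  every global algebraic `d`-form `ω ∈ Ωᵈ_{X/k}(X) = ⋀ᵈ_A Ω_{A/k}`, `A = Γ(X, 𝒪_X)` (Mathlib's
  `KaehlerDifferential` and `exteriorPower`, see `TopForms`), has a class `[ω] ∈ Hᵈ_dR(X, D)`:
  `ω` is closed (`Ωᵈ⁺¹_X = 0`) and restricts to zero in `Ωᵈ_h(D) = 0` (`d > dim D`,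
  Huber–Jörder 2014, Prop. 4.2), so it is a closed global section of the complex of `h`-sheaves
  `Ω•_h/(X,D) = Ker(Ω•_h/X → i_*Ω•_h/D)` defining `H•_dR(X, D)` (Huber–Müller-Stach, draft I,
  Def. 3.2.6; 2017, Ch. 3). These are exactly the symbols of Kontsevich's definition of formal
  periods (Kontsevich 1999, Def. 20; Huber–Müller-Stach draft III, Def. 9.1.1, Rem. 12.1.7:
  "differential forms of top degree rather than cohomology classes; they are automatically
  closed"). `formClass` is additive and `k`-linear (`formClass_smul`) and natural for morphisms
  of such pairs of the same dimension (`map_formClass`; functoriality of de Rham cohomology is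
  induced by pull-back of forms, draft I §3.1.2) — the "edge of type (F)" of the route.
* **The connecting morphisms on presented forms and chains** (`coboundary_formClass`,
  `boundary_chainClass`). For a triple `Z ⊆ Y ⊆ X` with `Y`, `X` smooth affine of relative
  dimensions `i`, `i + 1`: the de Rham connecting morphism sends the class of a top form `η` on
  `Y`, presented through functions restricted from `X`, to the class of `dη̃` for the presented
  lift `η̃` (long exact sequence of the triple, draft I Prop. 3.2.9, as the connecting morphism of
  `0 → Ω_h/(X,Y) → Ω_h/(X,Z) → i_{Y*}Ω_h/(Y,Z) → 0`, Rem. 3.2.10: lift and differentiate); the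
  Betti connecting morphism sends the class of a relative `(i+1)`-cycle `c` on `X(ℂ)` whose
  boundary is the push-forward of a chain `c'` on `Y(ℂ)` to the class of `c'` (Hatcher 2002,
  §2.1, p. 118 and p. 139: the boundary map of the triple is `j_* ∂`, `∂[c] = [∂c]`). The two are
  tied to each other by the field `pairing_coboundary` (`∫_γ δω = ∫_{∂γ} ω`,
  Huber–Müller-Stach 2017, Lemma 11.1.3 (2)) of `BoundaryData` and Stokes' formula; see the
  design note on signs.
* **The period formula** (`pairing_formClass`). For `Y = (X, D)` as above, functions
  `g₁, …, g_N` generating `A = Γ(X, 𝒪_X)` (a closed embedding `X ↪ 𝔸ᴺ`), a form presented as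
  `ω = ∑_I f_I(g) dg_{I(1)} ∧ ⋯ ∧ dg_{I(d)}` and a relative `d`-cycle `c = ∑ m_φ φ` on
  `(X_σ(ℂ), D_σ(ℂ))` whose simplices are *semi-algebraic* (their coordinate functions
  `gₙ ∘ φ`, in Warner's coordinates on `Δ_d`, have semi-algebraic real and imaginary parts):
  `∫_{[c]} [ω] = ∑_φ m_φ ∫_{Δ_d°} ∑_I σ(f_I)(g(φ(t))) det(∂_l (g_{I(j)} ∘ φ)(t)) dt`, the
  Lebesgue integral over the open standard simplex of the pulled-back density (defined through
  `fderiv`, almost everywhere for semi-algebraic maps). Printed: the period of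
  `(X, D, ω, Γ)` is `∑ αᵢ ∫_{Δ_d} γᵢ^* ω` for differentiable simplices and equals the
  cohomological period pairing (Huber–Müller-Stach draft III, Def. 9.1.1, Lemma 9.1.6,
  Lemma 9.3.4 = 2017, §11.1; draft I, Thm. 5.3.3, Def. 5.4.1 = 2017, Ch. 5), and the period
  pairing "can be computed by integration on continuous definable simplices", the integrals
  converging absolutely and Stokes' formula holding without regularity assumptions (Huber 2023,
  Thm. 7.5, Prop. 6.1, Prop. 5.4, Notation 7.1).

The Betti side needs no positing: relative singular homology of the complex points is honest in
the tree (G04), and this file adds the honest constructor `chainClass` (the class of a concrete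
relative cycle, via `Subcomplex.relCls` and `relativeSingularHomology.concreteIso`) and the
relative-cycle predicate `IsRelCycle`.

## WARNING — an interface, with junk models (read before using)

`ClassicalPeriodDatum k` is a *hypothesis structure*, exactly like `PeriodRealization`,
`RelativePeriodData` and `BoundaryData` which it bundles: its intended value is the classical
datum (algebraic de Rham cohomology of pairs over `k`, singular homology of complex points, the
period pairing, the connecting morphisms, the class map of Kähler forms), which satisfies every
field by the theorems cited at that field, and which the tree cannot construct. Consequently

1. a statement `∀ 𝒞 : ClassicalPeriodDatum k, …` is a statement about every model of these
   axioms and `∃ 𝒞 : ClassicalPeriodDatum k, …` is witnessed by any model; routes that mean the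
   classical datum should say which reading they intend (the planner's `KZTransferPackage` is
   existential), and refuters should keep in mind that the fields below pin the pairing only on
   classes of top forms on smooth affine pairs against semi-algebraic chains — symbols which,
   by Huber–Müller-Stach draft III, Cor. 12.1.6 (2) (= 2017, Cor. 13.1.7 (2)) and semi-algebraic
   triangulation (draft I, Prop. 2.6.8), generate the space of effective formal periods and
   evaluate to every effective period, but need not present all its relations (draft III,
   Rem. 12.1.7);
2. nothing here asserts that such a datum exists (that would be the construction item); no
   `Nonempty (ClassicalPeriodDatum k)` is claimed.

## Main definitions

* `Literature.AlgebraicGeometry.Motives.GlobalFunctions X` : `Γ(X, 𝒪_X)` of a `k`-scheme as a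
  `k`-algebra; `GlobalFunctions.comap f`; `GlobalFunctions.evalAt σ Q a` (the value `a(Q) ∈ ℂ`
  of a global function at a complex point of `X_σ`).
* `Literature.AlgebraicGeometry.Motives.TopForms X d = ⋀ᵈ_A Ω_{A/k}`; `TopForms.ofPolynomial g f`
  (the form `∑_I f_I(g) dg_I`); `TopForms.dPoly f` (coefficients of its exterior derivative).
* `Literature.AlgebraicGeometry.Motives.closedSimplex d`, `openSimplex d`, `toStdSimplex`
  (Warner's coordinates `(a₁, …, a_d) ↦ (1 - ∑ aᵢ, a₁, …, a_d)` on the standard simplex),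
  `simplexCoord σ φ a` (the coordinate function `a ∘ φ` of a singular simplex),
  `pullbackDensity σ φ g f` (the density of `φ^*ω` in these coordinates).
* `Literature.AlgebraicGeometry.Motives.IsRelCycle A n c`, `chainClass A n c hc` : concrete
  relative cycles and their classes in G04's relative singular homology.
* `Literature.AlgebraicGeometry.Motives.SchemePair.IsSmoothAffinePair Y d`.
* `Literature.AlgebraicGeometry.Motives.ClassicalPeriodDatum k` : the hypothesis structure.

## Design notes

* Mathlib: searched `deRham`, `KaehlerDifferential`, `exteriorPower`, `period`, `stdSimplex`,
  `singular` — Mathlib has Kähler differentials `Ω[A⁄k]` with the universal derivation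
  `KaehlerDifferential.D`, exterior powers `⋀[A]^d M` with `exteriorPower.ιMulti`, partial
  derivatives of polynomials `MvPolynomial.pderiv`, `fderiv`, the Bochner integral, the standard
  simplex `stdSimplex ℝ (Fin (n+1))` underlying its singular simplicial set, `SmoothOfRelativeDimension`,
  `IsAffine`, `topologicalKrullDim`; no de Rham complex of a commutative algebra (no exterior
  derivative on `⋀• Ω`), no algebraic de Rham cohomology, no integration of differential forms.
  Hence forms are honest (`TopForms`), but the exterior derivative and the analytic pull-back are
  only spelled out on *presented* forms `ofPolynomial g f` (every top form on an affine `X` is of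
  this shape for `g` generating `Γ(X, 𝒪_X)`), through the polynomial data: `dPoly` and
  `pullbackDensity`.
* Generality. The structure is stated for any field `k` of characteristic zero (the fields are
  indexed by embeddings `σ : k →+* ℂ`, as in `RelativePeriodData`); the route instantiates
  `k := AlgebraicClosure ℚ`. The class map is restricted to *top* degree on smooth affine `X`
  (where closedness and, for `dim D < d`, vanishing on `D` are automatic), which is what
  Kontsevich's symbols and the very good pairs of Huber–Müller-Stach 2017, Cor. 13.1.7 use; no
  class map is posited for singular `X` (there, de Rham classes are hypercohomology classes, not
  global forms: draft III, Rem. 12.1.7).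
* Scope of the period formula. Printed for `D` a (simple) normal crossings divisor and
  differentiable simplices (Huber–Müller-Stach) and for definable continuous simplices on
  definable manifolds (Huber 2023, Thm. 7.5); the field quantifies over the Lean-expressible
  class `dim D < d` and semi-algebraic simplices. For such `D` the formula reduces to the normal
  crossings case by an embedded resolution `π : (X̃, D̃) → (X, D)` of `D` (Hironaka), excision
  `H(X̃, D̃) ≅ H(X, D)` on both sides (draft I, Prop. 3.2.11) and the transformation rule for
  definable maps (Huber 2023, Prop. 5.10); integrals over semi-algebraic simplices inside `D(ℂ)`
  vanish because `ω` is of type `(d, 0)` and `D(ℂ)` is stratified by complex submanifolds of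
  dimension `< d`. The simplices are required semi-algebraic *through the generating functions*
  `g` (hypothesis `Algebra.adjoin k (range g) = ⊤`, i.e. `g : X ↪ 𝔸ᴺ` is a closed embedding and
  `X_σ(ℂ) ≅ V(I) ⊆ ℂᴺ = ℝ²ᴺ` is a semi-algebraic real-analytic manifold), which is what makes
  "semi-algebraic simplex of `X(ℂ)`" meaningful; the density uses `fderiv`, defined almost
  everywhere on the open simplex for semi-algebraic coordinates (elsewhere its junk value `0`
  does not affect the Lebesgue integral).
* Orientation and signs. `Δ_d` is parametrised by Warner's coordinates
  `t = (t₁, …, t_d) ↦ (1 - ∑ tᵢ, t₁, …, t_d)` (`toStdSimplex`; Huber 2023, §1, following Warner),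
  the positively oriented chart of `[e₀, …, e_d]` (`∂/∂tₗ = eₗ - e₀`), for which Stokes' formula
  holds with the singular boundary `∂φ = ∑ (-1)ⁱ φ ∘ δᵢ` of G04 / Mathlib (draft I, Def. 2.2.2)
  and the period pairing is `∑ αᵢ ∫_{Δ_d} γᵢ^*ω` (draft III, Def. 9.1.1). The Betti connecting
  morphism is normalised to Hatcher's `[c] ↦ [∂c]` (`boundary_chainClass`); given the field
  `pairing_coboundary` of `BoundaryData` (`∫_γ δω = ∫_{∂γ} ω`), Stokes' formula and perfectness,
  this forces the de Rham connecting morphism to be `[η] ↦ [dη̃]` with the same sign, which is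
  what `coboundary_formClass` records (both simultaneous sign flips of `(∂, δ)` inhabit
  `BoundaryData`; the fields here pick the printed one).
* `formClass` is an additive map with a separate `k`-linearity field through
  `algebraMap k Γ(X, 𝒪_X)` (the `k`-module structure on `⋀ᵈ_A Ω_{A/k}` by restriction of
  scalars is not used, to keep instance search first-order).
* `IsRelCycle A n c` is stated with the abstract differential `d n (next n)` of the concrete
  singular chain complex so that it makes sense in every degree (`isRelCycle_zero`,
  `isRelCycle_succ_iff`).
* Universe `0` for the structure (forced by `PeriodRealization`, `ComplexPoints`); the auxiliary
  definitions are universe polymorphic where possible.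

## References

* A. Huber, S. Müller-Stach, *Periods and Nori Motives*, Springer (2017), Ch. 3, Ch. 5, §11.1,
  Lemma 11.1.3, Thm. 12.2.1, Def. 13.1.1, Cor. 13.1.7 (`HuberMullerStachPeriods2017`); drafts
  Part I of June 8, 2015 (`HuberMullerStachPeriodsI2015`: Def. 2.2.2, Def. 3.1.1, §3.1.2,
  Def. 3.2.3, Prop. 3.2.4, Def. 3.2.6, Prop. 3.2.9, Rem. 3.2.10, Prop. 3.2.11, Prop. 3.3.19,
  Thm. 5.3.3, Def. 5.4.1, Lemma 5.4.2) and Part III of August 4, 2015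
  (`HuberMullerStachPeriodsIII2015`: Def. 9.1.1, Lemma 9.1.6, Lemma 9.3.4, Cor. 12.1.6,
  Rem. 12.1.7, Def. 12.1.8).
* A. Huber, C. Jörder, *Differential forms in the h-topology*, Algebr. Geom. 1 (2014), Prop. 4.2
  (`HuberJorder2014`).
* A. Huber, *The period isomorphism in tame geometry*, Math. Nachr. 297 (2023) = arXiv:2204.01402,
  §1, Notation 7.1, Prop. 5.4, Prop. 6.1, Prop. 7.4, Thm. 7.5 (`Huber2023`).
* M. Kontsevich, *Operads and motives in deformation quantization* (1999), §4, Def. 20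
  (`Kontsevich1999`).
* A. Hatcher, *Algebraic Topology*, CUP (2002), §2.1, pp. 115–118, 139 (`HatcherAT2002`).
-/

noncomputable section

open CategoryTheory AlgebraicGeometry Opposite MeasureTheory
open Literature.AlgebraicTopology.SingularHomology

universe u

namespace Literature.AlgebraicGeometry.Motives

/-! ### Global functions of a `k`-scheme -/

section GlobalFunctions

variable {k : Type u} [Field k]

/-- The ring of global functions `Γ(X, 𝒪_X)` of a `k`-scheme `X`, as a type (a synonym of
`Γ(X.left, ⊤)` carrying the `k`-algebra structure below; Hartshorne II.2). [folklore] -/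
def GlobalFunctions (X : SchemeOver k) : Type u := Γ(X.left, ⊤)

namespace GlobalFunctions

variable (X : SchemeOver k)

/-- `Γ(X, 𝒪_X)` is a commutative ring (the ring structure of `Γ(X.left, ⊤)`; Hartshorne II.2). [folklore] -/
instance instCommRing : CommRing (GlobalFunctions X) := inferInstanceAs (CommRing Γ(X.left, ⊤))

/-- `Γ(X, 𝒪_X)` is a `k`-algebra through the structure map `X → Spec k`:
`k ≅ Γ(Spec k, 𝒪) → Γ(X, 𝒪_X)` (Mathlib `Scheme.ΓSpecIso`, `Scheme.Hom.appTop`;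
Hartshorne II.2). [folklore] -/
instance instAlgebra : Algebra k (GlobalFunctions X) :=
  ((Scheme.ΓSpecIso (CommRingCat.of k)).inv ≫ X.hom.appTop).hom.toAlgebra

/-- The structure map of the `k`-algebra `Γ(X, 𝒪_X)`, unfolded. [folklore] -/
lemma algebraMap_eq :
    algebraMap k (GlobalFunctions X) = ((Scheme.ΓSpecIso (CommRingCat.of k)).inv ≫ X.hom.appTop).hom :=
  rfl

variable {X}

/-- Pull-back of global functions `f^* : Γ(Y, 𝒪_Y) → Γ(X, 𝒪_X)` along a `k`-morphism `f : X ⟶ Y`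
(Mathlib `Scheme.Hom.appTop`; Hartshorne II.2). [folklore] -/
def comap {Y : SchemeOver k} (f : X ⟶ Y) : GlobalFunctions Y →+* GlobalFunctions X :=
  f.left.appTop.hom

/-- `comap` is `appTop` as a function. [folklore] -/
lemma comap_apply {Y : SchemeOver k} (f : X ⟶ Y) (a : GlobalFunctions Y) :
    comap f a = f.left.appTop.hom a := rfl

end GlobalFunctions

end GlobalFunctions

section Eval

variable {k : Type} [Field k]

/-- The value `a(Q) ∈ ℂ` of a global function `a ∈ Γ(X, 𝒪_X)` at a complex point `Q` of the base
change `X_σ` along `σ : k →+* ℂ`: pull `a` back along `Spec ℂ →Q X_σ → X` and read it in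
`Γ(Spec ℂ, 𝒪) ≅ ℂ` (Mumford, *Red Book*, I.10; Huber–Müller-Stach, draft I, §1.2.1, the points
of the analytification `(X ×_k ℂ)^an`). [cite: HuberMullerStachPeriodsI2015, §1.2.1] -/
def GlobalFunctions.evalAt (σ : k →+* ℂ) {X : SchemeOver k}
    (Q : ComplexPoints ((baseChangeHom σ).obj X)) (a : GlobalFunctions X) : ℂ :=
  (Scheme.ΓSpecIso (CommRingCat.of ℂ)).hom.hom ((Q.left ≫ baseChangeHomFst σ X).appTop.hom a)

end Eval

/-! ### Top-degree Kähler forms on an affine scheme and their polynomial presentations -/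

section Forms

variable {k : Type u} [Field k]

/-- The global algebraic `d`-forms `Ωᵈ_{X/k}(X) = ⋀ᵈ_A Ω_{A/k}`, `A = Γ(X, 𝒪_X)`, of an affine
`k`-scheme `X` (Huber–Müller-Stach, draft I, Def. 3.1.1: `Ωᵖ_X = Λᵖ Ω¹_X`; for `X = Spec A` affine,
global sections of the quasi-coherent sheaf `Ωᵖ_X` are `⋀ᵖ_A Ω_{A/k}`), built from Mathlib's
`KaehlerDifferential` and `exteriorPower`. Meaningful for `X` affine.
[cite: HuberMullerStachPeriodsI2015, Def. 3.1.1] -/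
abbrev TopForms (X : SchemeOver k) (d : ℕ) : Type u :=
  ↥(⋀[GlobalFunctions X]^d (KaehlerDifferential k (GlobalFunctions X)))

namespace TopForms

variable {X : SchemeOver k} {d N : ℕ}

/-- The form `∑_I f_I(g₁, …, g_N) dg_{I(0)} ∧ ⋯ ∧ dg_{I(d-1)} ∈ Ωᵈ(X)` presented by global functions
`g : Fin N → Γ(X, 𝒪_X)` and polynomial coefficients `f_I ∈ k[x₁, …, x_N]`, one for each map
`I : Fin d → Fin N` (Huber–Müller-Stach, draft I, Def. 3.1.1: local — on affine `X` with `g`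
generating, global — shape `∑ f dt_{i₁} ∧ ⋯ ∧ dt_{i_p}` of a `p`-form).
[cite: HuberMullerStachPeriodsI2015, Def. 3.1.1] -/
def ofPolynomial (g : Fin N → GlobalFunctions X) (f : (Fin d → Fin N) → MvPolynomial (Fin N) k) :
    TopForms X d :=
  ∑ I : Fin d → Fin N, (MvPolynomial.aeval g (f I)) •
    exteriorPower.ιMulti (GlobalFunctions X) d
      (fun j => KaehlerDifferential.D k (GlobalFunctions X) (g (I j)))

/-- The polynomial coefficients of the exterior derivative of a presented form:
`d(∑_I f_I(g) dg_I) = ∑_I ∑_n (∂ₙ f_I)(g) dgₙ ∧ dg_I`, i.e. the coefficient of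
`J = (n, I) : Fin (d + 1) → Fin N` is `∂_{J 0} f_{tail J}` (Huber–Müller-Stach, draft I,
Def. 3.1.1: `dω = ∑ df_{i₁…i_p} ∧ dt_{i₁} ∧ ⋯ ∧ dt_{i_p}`). [cite: HuberMullerStachPeriodsI2015, Def. 3.1.1] -/
def dPoly (f : (Fin d → Fin N) → MvPolynomial (Fin N) k) :
    (Fin (d + 1) → Fin N) → MvPolynomial (Fin N) k :=
  fun J => MvPolynomial.pderiv (J 0) (f (Fin.tail J))

/-- `dPoly` unfolded. [folklore] -/
lemma dPoly_apply (f : (Fin d → Fin N) → MvPolynomial (Fin N) k) (J : Fin (d + 1) → Fin N) :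
    dPoly f J = MvPolynomial.pderiv (J 0) (f (Fin.tail J)) := rfl

/-- Presentations are additive in the coefficients: `ω_{g, f + f'} = ω_{g, f} + ω_{g, f'}`. [folklore] -/
lemma ofPolynomial_add (g : Fin N → GlobalFunctions X) (f f' : (Fin d → Fin N) → MvPolynomial (Fin N) k) :
    ofPolynomial g (f + f') = ofPolynomial g f + ofPolynomial g f' := by
  simp only [ofPolynomial, Pi.add_apply, map_add, add_smul, Finset.sum_add_distrib]

/-- The zero presentation gives the zero form. [folklore] -/
@[simp]
lemma ofPolynomial_zero (g : Fin N → GlobalFunctions X) :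
    ofPolynomial g (0 : (Fin d → Fin N) → MvPolynomial (Fin N) k) = 0 := by
  simp [ofPolynomial]

/-- `dPoly` is additive. [folklore] -/
lemma dPoly_add (f f' : (Fin d → Fin N) → MvPolynomial (Fin N) k) :
    dPoly (f + f') = dPoly f + dPoly f' := by
  funext J
  simp [dPoly, map_add]

end TopForms

end Forms

/-! ### The standard simplex in Warner's coordinates; coordinates and densities of simplices -/

section Simplex

/-- The closed standard `d`-simplex in Warner's coordinates,
`Δ_d = {(t₁, …, t_d) ∈ ℝᵈ | tᵢ ≥ 0, ∑ tᵢ ≤ 1}` (Huber 2023, §1, following Warner GTM 94).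
[cite: Huber2023, §1] -/
def closedSimplex (d : ℕ) : Set (Fin d → ℝ) := {t | (∀ i, 0 ≤ t i) ∧ ∑ i, t i ≤ 1}

/-- The open standard `d`-simplex `{(t₁, …, t_d) | tᵢ > 0, ∑ tᵢ < 1}`, the interior of
`closedSimplex d` (Huber 2023, §1, "open face"). [cite: Huber2023, §1] -/
def openSimplex (d : ℕ) : Set (Fin d → ℝ) := {t | (∀ i, 0 < t i) ∧ ∑ i, t i < 1}

/-- Membership in `closedSimplex`, unfolded. [folklore] -/
@[simp] lemma mem_closedSimplex_iff {d : ℕ} {t : Fin d → ℝ} :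
    t ∈ closedSimplex d ↔ (∀ i, 0 ≤ t i) ∧ ∑ i, t i ≤ 1 := Iff.rfl

/-- Membership in `openSimplex`, unfolded. [folklore] -/
@[simp] lemma mem_openSimplex_iff {d : ℕ} {t : Fin d → ℝ} :
    t ∈ openSimplex d ↔ (∀ i, 0 < t i) ∧ ∑ i, t i < 1 := Iff.rfl

/-- The open simplex is contained in the closed one. [folklore] -/
lemma openSimplex_subset_closedSimplex (d : ℕ) : openSimplex d ⊆ closedSimplex d :=
  fun _ ht => ⟨fun i => (ht.1 i).le, ht.2.le⟩

/-- Warner's parametrisation of the standard topological simplex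
`stdSimplex ℝ (Fin (d + 1)) = {(a₀, …, a_d) | aᵢ ≥ 0, ∑ aᵢ = 1}` by `closedSimplex d`:
`(t₁, …, t_d) ↦ (1 - ∑ tᵢ, t₁, …, t_d)`, the positively oriented affine chart of `[e₀, …, e_d]`
centred at the vertex `e₀` (`∂/∂tₗ = eₗ - e₀`); outside `closedSimplex d` it takes the junk value
`e₀` (Huber 2023, §1; Huber–Müller-Stach, draft I, Def. 2.2.1). [cite: Huber2023, §1] -/
def toStdSimplex {d : ℕ} (t : Fin d → ℝ) : stdSimplex ℝ (Fin (d + 1)) :=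
  open Classical in
  if ht : t ∈ closedSimplex d then
    ⟨Fin.cons (1 - ∑ i, t i) t, by
      refine ⟨fun i => ?_, ?_⟩
      · refine Fin.cases ?_ (fun j => ?_) i
        · simpa using ht.2
        · simpa using ht.1 j
      · simp [Fin.sum_cons]⟩
  else
    ⟨Pi.single 0 1, by
      refine ⟨fun i => ?_, by simp⟩
      by_cases hi : i = 0
      · subst hi; simp
      · simp [hi]⟩

/-- On the closed simplex, `toStdSimplex t = (1 - ∑ tᵢ, t₁, …, t_d)`. [folklore] -/
lemma coe_toStdSimplex_of_mem {d : ℕ} {t : Fin d → ℝ} (ht : t ∈ closedSimplex d) :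
    (toStdSimplex t : Fin (d + 1) → ℝ) = Fin.cons (1 - ∑ i, t i) t := by
  simp only [toStdSimplex, dif_pos ht]
  rfl

/-- The coordinates `t₁, …, t_d` are recovered from `toStdSimplex t` as its last `d` entries. [folklore] -/
lemma toStdSimplex_succ {d : ℕ} {t : Fin d → ℝ} (ht : t ∈ closedSimplex d) (j : Fin d) :
    (toStdSimplex t : Fin (d + 1) → ℝ) j.succ = t j := by
  rw [coe_toStdSimplex_of_mem ht, Fin.cons_succ]

variable {k : Type} [Field k]

/-- The coordinate function `t ↦ a(φ(t))` on `ℝᵈ` (meaningful on `closedSimplex d`) of a singular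
`d`-simplex `φ` of the complex points `X_σ(ℂ)` with respect to a global function
`a ∈ Γ(X, 𝒪_X)`, in Warner's coordinates (Huber–Müller-Stach, draft III, Def. 9.1.1, the maps
`γᵢ : Δ_d → X^an` read through regular functions; Huber 2023, §1). [cite: HuberMullerStachPeriodsIII2015, Def. 9.1.1] -/
def simplexCoord (σ : k →+* ℂ) {X : SchemeOver k} {d : ℕ}
    (φ : SingularSimplex (ComplexPoints ((baseChangeHom σ).obj X)) d) (a : GlobalFunctions X) :
    (Fin d → ℝ) → ℂ :=
  fun t => GlobalFunctions.evalAt σ (SingularSimplex.toContinuousMap φ (toStdSimplex t)) a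

/-- The density of the pull-back `φ^*ω` of the presented form `ω = ∑_I f_I(g) dg_I` along a
singular simplex `φ` of `X_σ(ℂ)`, in Warner's coordinates on `ℝᵈ`:
`t ↦ ∑_I σ(f_I)(g(φ(t))) · det (∂_{tₗ} (g_{I(j)} ∘ φ)(t))_{j,l}`, so that
`∫_{Δ_d} φ^*ω = ∫_{openSimplex d} pullbackDensity dt` whenever the coordinate functions are
differentiable almost everywhere with integrable density (Huber–Müller-Stach, draft III,
Def. 9.1.1; draft I, Thm. 5.3.3; Huber 2023, Lemma 2.3: `σ^*(∑ a_I dx_I) = ∑ (a_I ∘ σ) σ^*(dx_I)`).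
The derivative is Mathlib's `fderiv` (junk value `0` where `g ∘ φ` is not differentiable).
[cite: HuberMullerStachPeriodsIII2015, Def. 9.1.1] -/
def pullbackDensity (σ : k →+* ℂ) {X : SchemeOver k} {d N : ℕ}
    (φ : SingularSimplex (ComplexPoints ((baseChangeHom σ).obj X)) d)
    (g : Fin N → GlobalFunctions X) (f : (Fin d → Fin N) → MvPolynomial (Fin N) k) :
    (Fin d → ℝ) → ℂ :=
  fun t => ∑ I : Fin d → Fin N,
    MvPolynomial.eval₂ σ (fun n => simplexCoord σ φ (g n) t) (f I) *
      (Matrix.of fun j l : Fin d => fderiv ℝ (simplexCoord σ φ (g (I j))) t (Pi.single l 1)).det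

end Simplex

/-! ### Concrete relative cycles and their classes (G04) -/

section Chains

variable {T : Type u} [TopologicalSpace T]

/-- A concrete singular `n`-chain `c` with rational coefficients on `T` is a **relative cycle** for
the subspace `A ⊆ T` if its boundary is a chain in `A` (Hatcher 2002, §2.1, "relative cycles";
stated with the differential `d n (next n)` of the concrete singular chain complex of G04, so that
it makes sense in every degree). [cite: HatcherAT2002, §2.1] -/
def IsRelCycle (A : Set T) (n : ℕ) (c : CChain ℚ T n) : Prop :=
  (csingularChainComplex ℚ ℚ T).d n ((ComplexShape.down ℕ).next n) c ∈
    chainsIn ℚ ℚ T A ((ComplexShape.down ℕ).next n)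

/-- Every `0`-chain is a relative cycle. [folklore] -/
lemma isRelCycle_zero (A : Set T) (c : CChain ℚ T 0) : IsRelCycle A 0 c := by
  unfold IsRelCycle
  rw [(csingularChainComplex ℚ ℚ T).shape 0 _ (by simp [ChainComplex.next_nat_zero])]
  exact Submodule.zero_mem _

/-- In positive degree, `c` is a relative cycle iff its concrete boundary `bd c` is a chain in `A`
(Hatcher 2002, §2.1). [cite: HatcherAT2002, §2.1] -/
lemma isRelCycle_succ_iff (A : Set T) (n : ℕ) (c : CChain ℚ T (n + 1)) :
    IsRelCycle A (n + 1) c ↔ csingularChainComplex.bd ℚ n c ∈ chainsIn ℚ ℚ T A n := by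
  unfold IsRelCycle
  rw [ChainComplex.next_nat_succ, csingularChainComplex.d_apply]
  exact Iff.rfl

/-- The class `[c] ∈ Hₙ(T, A; ℚ)` of a concrete relative cycle `c` in G04's relative singular
homology `relativeSingularHomology ℚ ℚ T A n`: the relative class `Subcomplex.relCls` in the
concrete model `Hₙ(C(T)/C(A))`, transported along `relativeSingularHomology.concreteIso`
(Hatcher 2002, §2.1, `Hₙ(X, A) = Ker ∂ / Im ∂` of `Cₙ(X)/Cₙ(A)`). [cite: HatcherAT2002, §2.1] -/
def chainClass (A : Set T) (n : ℕ) (c : CChain ℚ T n) (hc : IsRelCycle A n c) :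
    relativeSingularHomology ℚ ℚ T A n :=
  (relativeSingularHomology.concreteIso ℚ ℚ T A n).inv ((chainsInSub ℚ ℚ T A).relCls c hc)

/-- `chainClass` in terms of the concrete model: its image under `concreteIso` is `relCls c`. [folklore] -/
lemma concreteIso_hom_chainClass (A : Set T) (n : ℕ) (c : CChain ℚ T n) (hc : IsRelCycle A n c) :
    (relativeSingularHomology.concreteIso ℚ ℚ T A n).hom (chainClass A n c hc) =
      (chainsInSub ℚ ℚ T A).relCls c hc := by
  rw [chainClass, ← ModuleCat.comp_apply, Iso.inv_hom_id, ModuleCat.id_apply]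

/-- The class of the zero chain is zero. [folklore] -/
lemma chainClass_zero (A : Set T) (n : ℕ) (h0 : IsRelCycle A n 0) : chainClass A n 0 h0 = 0 := by
  unfold chainClass
  erw [Subcomplex.relCls_zero]
  exact map_zero _

end Chains

/-! ### Smooth affine pairs -/

namespace SchemePair

variable {k : Type u} [Field k]

/-- A pair `(X, D)` is a **smooth affine pair of dimension `d`** if `X` is affine and smooth of
relative dimension `d` over `k` and `D` has (Krull) dimension `< d` — the pairs on which global
top-degree forms have canonical relative de Rham classes: `ω ∈ Ωᵈ(X)` is closed and restricts to
`0 = Ωᵈ_h(D)` (Huber–Jörder 2014, Prop. 4.2; Huber–Müller-Stach, draft III, Def. 9.1.1 with `D` a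
normal crossings divisor; Cor. 12.1.6 (1): `X` affine of dimension `d`, `D` of dimension `d - 1`).
For `D = ∅` the dimension condition is vacuous (`dim ∅ = ⊥`).
[cite: HuberMullerStachPeriodsIII2015, Def. 9.1.1 and Cor. 12.1.6 (1)] -/
structure IsSmoothAffinePair (Y : SchemePair k) (d : ℕ) : Prop where
  /-- `X` is an affine scheme. -/
  isAffine : IsAffine Y.X.left
  /-- `X → Spec k` is smooth of relative dimension `d`. -/
  smooth : SmoothOfRelativeDimension d Y.X.hom
  /-- `dim D < d` (topological Krull dimension of the underlying space of `D`). -/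
  dim_lt : topologicalKrullDim Y.D.left < d

end SchemePair

/-! ### The hypothesis structure -/

open Literature.NumberTheory.Transcendental (SchemeTriple IsSemialgebraicFunOn)

/-- The **classical period datum** over a field `k` of characteristic zero, as a hypothesis
structure: a period realization `P`, relative period data `R` over `P` and boundary data `B`
for `R` (preludes C9, C10 and `Sweep1`: algebraic de Rham cohomology of pairs, singular homology
of the complex points along each `σ : k →+* ℂ`, the period pairing and the connecting morphisms
of triples; Huber–Müller-Stach 2017, Ch. 3, §11.1, Lemma 11.1.3), **together with** the
normalisations that the classical datum satisfies and that pin its periods on Kontsevich's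
symbols: the classes `formClass [ω] ∈ Hᵈ_dR(X, D)` of global top-degree Kähler forms on smooth
affine pairs (Kontsevich 1999, Def. 20; Huber–Müller-Stach draft III, Def. 9.1.1, Rem. 12.1.7),
their `k`-linearity and naturality, the connecting morphisms on presented forms (`dη̃`) and on
concrete chains (`[c] ↦ [c']` when `∂c = ι_* c'`, Hatcher 2002, §2.1), and the period formula
`∫_{[c]} [ω] = ∑ m_φ ∫_{Δ_d} φ^*ω` for semi-algebraic relative cycles (Huber–Müller-Stach draft
III, Def. 9.1.1, Lemma 9.1.6, Lemma 9.3.4; draft I, Thm. 5.3.3; Huber 2023, Thm. 7.5).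
**An interface**: the tree cannot construct its intended (classical) value — see the module
docstring, § WARNING, before quantifying over it. [cite: HuberMullerStachPeriodsIII2015, Def. 9.1.1, Lemma 9.1.6, Lemma 9.3.4] -/
structure ClassicalPeriodDatum (k : Type) [Field k] [CharZero k] where
  /-- The period realization (algebraic de Rham and Betti cohomology, the comparison). -/
  P : PeriodRealization k
  /-- Relative algebraic de Rham cohomology of pairs and the period pairing. -/
  R : RelativePeriodData P
  /-- The connecting morphisms of triples. -/
  B : R.BoundaryData
  /-- The class `[ω] ∈ Hᵈ_dR(X, D)` of a global `d`-form `ω ∈ Ωᵈ(X)` on a smooth affine pair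
  `(X, D)` of dimension `d` (Kontsevich 1999, Def. 20; Huber–Müller-Stach draft III, Def. 9.1.1,
  Lemma 9.1.6; draft I, Def. 3.2.6 with Huber–Jörder 2014, Prop. 4.2), as an additive map. -/
  formClass ⦃d : ℕ⦄ ⦃Y : SchemePair k⦄ (hY : Y.IsSmoothAffinePair d) : TopForms Y.X d →+ R.obj Y d
  /-- The class map is `k`-linear: `[a ω] = a [ω]` for `a ∈ k` (Huber–Müller-Stach draft III,
  proof of Prop. 9.1.7: "multiplying `ω` by an element of `k`"). -/
  formClass_smul : ∀ ⦃d : ℕ⦄ ⦃Y : SchemePair k⦄ (hY : Y.IsSmoothAffinePair d) (a : k)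
    (ω : TopForms Y.X d),
      formClass hY (algebraMap k (GlobalFunctions Y.X) a • ω) = a • formClass hY ω
  /-- Naturality of the class map for a morphism `u : (X', D') ⟶ (X, D)` of smooth affine pairs of
  the same dimension `d`: `u^*[∑ f_I(g) dg_I] = [∑ f_I(u^*g) d(u^*g)_I]` (functoriality of de Rham
  cohomology is induced by pull-back of forms: Huber–Müller-Stach draft I, §3.1.2, Lemma 3.1.6;
  the route's edges of type (F)). -/
  map_formClass : ∀ ⦃d : ℕ⦄ ⦃Y Y' : SchemePair k⦄ (hY : Y.IsSmoothAffinePair d)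
    (hY' : Y'.IsSmoothAffinePair d) (u : Y' ⟶ Y) ⦃N : ℕ⦄ (g : Fin N → GlobalFunctions Y.X)
    (f : (Fin d → Fin N) → MvPolynomial (Fin N) k),
      R.map u d (formClass hY (TopForms.ofPolynomial g f)) =
        formClass hY' (TopForms.ofPolynomial (fun n => GlobalFunctions.comap u.fX (g n)) f)
  /-- The de Rham connecting morphism of a triple `Z ⊆ Y ⊆ X` with `(Y, Z)`, `(X, Y)` smooth
  affine pairs of dimensions `i`, `i + 1`, on presented forms: for `g : Fin N → Γ(X, 𝒪_X)` and
  the top form `η = ∑ f_I(g|_Y) d(g|_Y)_I` on `Y`, `δ[η] = [dη̃] ∈ Hⁱ⁺¹_dR(X, Y)` where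
  `η̃ = ∑ f_I(g) dg_I` lifts `η` and `dη̃ = ∑ (∂ₙ f_I)(g) dgₙ ∧ dg_I` (`TopForms.dPoly`)
  (long exact sequence of the triple as the cohomology sequence of
  `0 → Ω_h/(X,Y) → Ω_h/(X,Z) → i_{Y*}Ω_h/(Y,Z) → 0`: Huber–Müller-Stach draft I, Prop. 3.2.9,
  Rem. 3.2.10; sign fixed by `BoundaryData.pairing_coboundary` and Stokes, see the module
  docstring). -/
  coboundary_formClass : ∀ ⦃i : ℕ⦄ (T : SchemeTriple k) (hin : T.inner.IsSmoothAffinePair i)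
    (hout : T.outer.IsSmoothAffinePair (i + 1)) ⦃N : ℕ⦄ (g : Fin N → GlobalFunctions T.X)
    (f : (Fin i → Fin N) → MvPolynomial (Fin N) k),
      B.coboundary T i
          (formClass hin (TopForms.ofPolynomial (fun n => GlobalFunctions.comap T.ιY (g n)) f)) =
        formClass hout (TopForms.ofPolynomial g (TopForms.dPoly f))
  /-- The Betti connecting morphism of a triple `Z ⊆ Y ⊆ X` on concrete chains: if `c` is a
  relative `(i+1)`-cycle of `(X_σ(ℂ), Y_σ(ℂ))` whose boundary is the push-forward `ι_{Y*} c'` of a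
  relative `i`-cycle `c'` of `(Y_σ(ℂ), Z_σ(ℂ))`, then `∂[c] = [c']` (Hatcher 2002, §2.1, p. 118 and
  p. 139: the boundary map of the triple is `j_* ∂` with `∂[c] = [∂c]`; Huber–Müller-Stach 2017,
  Lemma 11.1.3 (2)). -/
  boundary_chainClass : ∀ (σ : k →+* ℂ) (T : SchemeTriple k) (i : ℕ)
    (c : CChain ℚ (ComplexPoints (T.outer.baseChange σ).X) (i + 1))
    (c' : CChain ℚ (ComplexPoints (T.inner.baseChange σ).X) i)
    (hc : IsRelCycle (T.outer.complexPointsSub σ) (i + 1) c)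
    (hc' : IsRelCycle (T.inner.complexPointsSub σ) i c'),
      (csingularChainComplex.map ℚ ℚ
          (AlgPoints.mapContinuous (L := ℂ) ((baseChangeHom σ).map T.ιY))).f i c' =
        csingularChainComplex.bd ℚ i c →
      B.boundary σ T i (chainClass (T.outer.complexPointsSub σ) (i + 1) c hc) =
        chainClass (T.inner.complexPointsSub σ) i c' hc'
  /-- **The period formula.** For a smooth affine pair `(X, D)` of dimension `d`, functions
  `g₁, …, g_N` generating `Γ(X, 𝒪_X)` over `k`, a presented top form `ω = ∑ f_I(g) dg_I` and a
  concrete relative `d`-cycle `c = ∑ m_φ φ` of `(X_σ(ℂ), D_σ(ℂ))` all of whose simplices are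
  semi-algebraic (the real and imaginary parts of their coordinate functions `gₙ ∘ φ` are
  semi-algebraic on `Δ_d`):
  `∫_{[c]} [ω] = ∑_φ m_φ ∫_{Δ_d°} pullbackDensity σ φ g f`, the period of the quadruple
  `(X, D, ω, c)` (Huber–Müller-Stach draft III, Def. 9.1.1, Lemma 9.1.6, Lemma 9.3.4; draft I,
  Thm. 5.3.3, Def. 5.4.1), computed on continuous semi-algebraic simplices (Huber 2023, Thm. 7.5,
  Prop. 6.1, Prop. 5.4: the integrals converge absolutely and Stokes' formula holds). Scope: see
  the module docstring (printed for `D` a normal crossings divisor; `dim D < d` by embedded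
  resolution, excision and the transformation rule). -/
  pairing_formClass : ∀ (σ : k →+* ℂ) ⦃d : ℕ⦄ ⦃Y : SchemePair k⦄ (hY : Y.IsSmoothAffinePair d)
    ⦃N : ℕ⦄ (g : Fin N → GlobalFunctions Y.X) (f : (Fin d → Fin N) → MvPolynomial (Fin N) k)
    (c : CChain ℚ (ComplexPoints (Y.baseChange σ).X) d) (hc : IsRelCycle (Y.complexPointsSub σ) d c),
      Algebra.adjoin k (Set.range g) = ⊤ →
      (∀ φ ∈ c.support, ∀ n : Fin N,
        IsSemialgebraicFunOn ℝ (closedSimplex d) (fun t => (simplexCoord σ φ (g n) t).re) ∧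
        IsSemialgebraicFunOn ℝ (closedSimplex d) (fun t => (simplexCoord σ φ (g n) t).im)) →
      R.pairing σ Y d (formClass hY (TopForms.ofPolynomial g f))
          (chainClass (Y.complexPointsSub σ) d c hc) =
        (AlongHom.equiv σ).symm
          (∑ φ ∈ c.support, (c φ : ℂ) * ∫ t in openSimplex d, pullbackDensity σ φ g f t)

namespace ClassicalPeriodDatum

variable {k : Type} [Field k] [CharZero k] (𝒞 : ClassicalPeriodDatum k)

/-- `[0] = 0`. [folklore] -/
@[simp]
lemma formClass_zero ⦃d : ℕ⦄ ⦃Y : SchemePair k⦄ (hY : Y.IsSmoothAffinePair d) :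
    𝒞.formClass hY 0 = 0 :=
  map_zero _

/-- `[ω + ω'] = [ω] + [ω']`. [folklore] -/
lemma formClass_add ⦃d : ℕ⦄ ⦃Y : SchemePair k⦄ (hY : Y.IsSmoothAffinePair d)
    (ω ω' : TopForms Y.X d) :
    𝒞.formClass hY (ω + ω') = 𝒞.formClass hY ω + 𝒞.formClass hY ω' :=
  map_add _ _ _

/-- The class of a presented form is additive in the polynomial coefficients. [folklore] -/
lemma formClass_ofPolynomial_add ⦃d : ℕ⦄ ⦃Y : SchemePair k⦄ (hY : Y.IsSmoothAffinePair d)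
    ⦃N : ℕ⦄ (g : Fin N → GlobalFunctions Y.X) (f f' : (Fin d → Fin N) → MvPolynomial (Fin N) k) :
    𝒞.formClass hY (TopForms.ofPolynomial g (f + f')) =
      𝒞.formClass hY (TopForms.ofPolynomial g f) + 𝒞.formClass hY (TopForms.ofPolynomial g f') := by
  rw [TopForms.ofPolynomial_add, map_add]

/-- The period of a symbol against the zero chain vanishes (the right-hand side of the period
formula for `c = 0` is `0`). [folklore] -/
lemma pairing_formClass_chainClass_zero (σ : k →+* ℂ) ⦃d : ℕ⦄ ⦃Y : SchemePair k⦄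
    (hY : Y.IsSmoothAffinePair d) (ω : TopForms Y.X d)
    (h0 : IsRelCycle (Y.complexPointsSub σ) d (0 : CChain ℚ (ComplexPoints (Y.baseChange σ).X) d)) :
    𝒞.R.pairing σ Y d (𝒞.formClass hY ω) (chainClass (Y.complexPointsSub σ) d 0 h0) = 0 := by
  rw [chainClass_zero, map_zero]

end ClassicalPeriodDatum

end Literature.AlgebraicGeometry.Motives

end
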